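import Summits.QuantumFields.YangMills.Theorems.UnitScaleTiltProp7MassivePropagatorSupBound
import HarnessLib

/-!
# Route `UnitScaleTilt`, crux K1 «MinimiserStabilityRegPr» (stmt-QuantumFields-19200), EX face after S45 — **(L3′b)-VALUE FILE V2b: THE COLUMNS `ψ_y = G_a(Q″†e_y)` OF THE
# LOD PROJECTOR ARE BLOCK-SOURCED AND POINTWISE BOUNDED, K-FREE** (★★OWNER RULING №35-A (b); chair ★`ym-ust-19200-p1` g25, over V2 ✓`Prop7MassivePropagatorSupBound` and routeR-w2's
# ✓`Prop7TopMeanAdjointBlockLocal.adjoint_apply_eq_zero_off_block`)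

Cell `ym3-torus` (HUMAN RULING D-0037; rung R3 = SU(2) YM₃ on T³ — NOT d = 4, NOT infinite volume, NOT a mass gap, NOT Clay).
THEOREMS ONLY (0 `def`, 0 `sorry`, default heartbeats); `--supports stmt-QuantumFields-19200 --as helper`; count-neutral.

WHY.  The structural identity of the LOD line (★p1 g24 ✓`Prop7LODProjectorGlue`, memo LOCATE-P349-CT §7 (E2)) writes the complementary projector as `P = B M⁻¹ Bᴴ` with COLUMNS
`ψ_y = G_a(T(ι e_y))` (`G_a = (Δ_{U₀} + aQ″†Q″)⁻¹`, `T(ι e_y) = Q″†e_y`), and ✓`Prop7ProjRangeKernelDecayCoarseGram.P_decay` turns POINTWISE column letters into the (3.49)-shaped pointwise kernel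
of `P`.  This file supplies the VALUE column letter: the source `Q″†(δ_y ⊗ Y)` is supported in the block `B^{K−n}(y)` (✓`adjoint_apply_eq_zero_off_block`) with values
`≤ (5∕4)√(2c₁)∕(c₀ℓ³)·√(2c₁)·‖Y‖` (V2's spike test ✓`norm_equiv_adjoint_apply_le`), so V2 ✓`norm_equiv_massiveInverse_apply_le` at `#S = ℓ³` bounds the column pointwise.
WHAT IS PROVED (ns `Summit.QuantumFields.YangMills.Theorems.Prop7MassiveColumnSupBound`; letters `hseq hι hT`, `G hAG` of ✓`Prop7ComplementaryProjectorBlockDecay` VERBATIM).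
* §1 (routeR-w2's ✓`inner_lift_eq_zero_of_disjoint` supplies the `hι` of ✓`adjoint_apply_eq_zero_off_block`) `norm_lift_single_le`
  (`‖ι(δ_y ⊗ Y)‖ ≤ √(2c₁)·‖Y‖`), `card_blockSites` (the block of `y` read on `TSite` has `(L^d)^{K−n}` points), ★`equiv_column_source_eq_zero_off_block`, ★`norm_equiv_column_source_le`.
* §2 ★★★ `norm_equiv_massiveColumn_apply_le` — `‖(G(T(ι(δ_y ⊗ Y))))(x)‖_{W₂} ≤ B_col·‖Y‖` at EVERY site, `B_col = B₀(#S := (L^d)^{K−n})·(5∕4)√(2c₁)∕(c₀ℓ³)·√(2c₁)` with V2's `B₀`; at the pin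
  `c₁ = c₀ℓ³`: `B_col = (5∕2)·(2 + ((25∕4)a + √27)·max 2 (16∕a))` — NO `K`, NO `n`, NO volume.
HONEST SCOPE.  Composition; the VALUE letter of the columns only (no decay — V3∕V4; no gradient — the (L3′b)-GRAD key); nothing of `P_decay`'s instantiation, the ten EX rows, `hT`, `hGF`, EX or
the crux is proved here.

References: T. Bałaban, CMP **99** (1985) 389–434 [Balaban1985BackgroundPropagators] ((3.16) p.393, (3.21)–(3.25) p.394, Thm 3.1 (3.42) p.397, (3.49) p.399); CMP **98** (1985) 17–51
[Balaban1985Averaging] ((97) p.32).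
-/

set_option autoImplicit false

noncomputable section

open scoped BigOperators Matrix.Norms.L2Operator InnerProductSpace ComplexConjugate

namespace Summit.QuantumFields.YangMills.Theorems.Prop7MassiveColumnSupBound

open Literature.MathematicalPhysics.QuantumFieldTheory.Balaban1983to89
open Finset
open T4Continuum BlockAveraging
open BlockAveraging (Idx)
open B7Prop1Explicit (U1 disp)
open B5Eq118OneStroke (iterBlockOf iterBlock mem_iterBlock card_iterBlock)
open B10Eq27TorusAxialLog (holT transl)
open B7TransferAnalyticMean (meanCLM)
open B4Sect5Torus (TSite)
open B9Eq311L2Pairing (WL2)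
open B11Eq103H1Complex (SiteL2K BondL2K)
open Summit.QuantumFields.YangMills.Theorems.Prop8Chart (emlIterU)
open Literature.MathematicalPhysics.QuantumFieldTheory.Balaban1983to89.T3ContinuumYM3Torus
open T3SectALandauChart (eta eta_pos bgUnits)
open T3PrintedRegularMinimiser (RegPr)
open T3PrintedRegularOrbits (sites_eq)
open T3LevelShift (siteShift)
open Summit.QuantumFields.YangMills.Theorems.Prop7SectET3Transport (periodsT3 siteEquiv)
open Summit.QuantumFields.YangMills.Theorems.Prop7SectET3HilbertLetters (W₂ frobEquiv toL2S covLapSite toL2S_apply toL2S_symm_apply inner_frobEquiv_symm)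
open Summit.QuantumFields.YangMills.Theorems.Prop7SectET3RealCoordSums (inner_toL2S)
open Summit.QuantumFields.YangMills.Theorems.Prop7RieszTauFrobNorm (norm_frobEquiv_symm_le)
open Summit.QuantumFields.YangMills.Theorems.Prop7BlockBumpExtension (normSq_toL2S_comp_siteShift_eq)
open Summit.QuantumFields.YangMills.Theorems.Prop7CovariantCoercivity (sum_norm_sq_le_mul_opNorm_sq)
open Summit.QuantumFields.YangMills.Theorems.Prop7TopMeanAdjointBlockLocal (adjoint_apply_eq_zero_off_block)
open Summit.QuantumFields.YangMills.Theorems.Prop7ComplementaryProjectorBlockDecay (inner_lift_eq_zero_of_disjoint)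
open Summit.QuantumFields.YangMills.Theorems.Prop7MassivePropagatorSupBound (norm_equiv_adjoint_apply_le norm_equiv_massiveInverse_apply_le)

variable (F : T3Family) {n K : ℕ} (h : n ≤ K) {c₀ c₁ : ℝ} [Fact (0 < c₀)] [Fact (0 < c₁)]
  {ε₀ : ℝ} (hε₀ : 0 < ε₀) (hε7 : 10 ^ 7 * (F.L : ℝ) ^ 3 * ε₀ ≤ 1)
  (U₀ : GaugeField (F.P K) 0 (Matrix.specialUnitaryGroup (Fin 2) ℂ)) (hreg : RegPr F n K ε₀ U₀)
  (Q'' : SiteL2K ℂ 3 (periodsT3 F K) c₀ W₂ →ₗ[ℂ] (Site (F.P K) (K - n) → Matrix (Fin 2) (Fin 2) ℂ))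
  (hseq : ∀ lam : Site (F.P K) 0 → Matrix (Fin 2) (Fin 2) ℂ, ∃ ns : (j : ℕ) → Site (F.P K) j → Matrix (Fin 2) (Fin 2) ℂ, ns 0 = lam ∧
      (∀ (j : ℕ) (y : Site (F.P K) (j + 1)), ns (j + 1) y = ns j (emb y) - meanCLM (Idx (F.P K)) (Matrix (Fin 2) (Fin 2) ℂ) fun i : Idx (F.P K) =>
        ns j (emb y) - ((holT (emlIterU j (bgUnits F K U₀)) (emb y) (stairWord i.2.1 (off i.1)) : (Matrix (Fin 2) (Fin 2) ℂ)ˣ) : Matrix (Fin 2) (Fin 2) ℂ) *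
          ns j (transl (emb y) (disp (stairWord i.2.1 (off i.1)))) * (((holT (emlIterU j (bgUnits F K U₀)) (emb y) (stairWord i.2.1 (off i.1)))⁻¹ : (Matrix (Fin 2) (Fin 2) ℂ)ˣ) : Matrix (Fin 2) (Fin 2) ℂ)) ∧
      ns (K - n) = Q'' (toL2S F K c₀ lam))
  (ι : (Site (F.P K) (K - n) → Matrix (Fin 2) (Fin 2) ℂ) →ₗ[ℂ] SiteL2K ℂ 3 (periodsT3 F n) c₁ W₂)
  (hι : ∀ c, ι c = toL2S F n c₁ (fun z => c (siteShift (sites_eq F n K h) z)))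
  (T : SiteL2K ℂ 3 (periodsT3 F n) c₁ W₂ →ₗ[ℂ] SiteL2K ℂ 3 (periodsT3 F K) c₀ W₂)
  (hT : ∀ (l : SiteL2K ℂ 3 (periodsT3 F K) c₀ W₂) (f : SiteL2K ℂ 3 (periodsT3 F n) c₁ W₂), ⟪ι (Q'' l), f⟫_ℂ = ⟪l, T f⟫_ℂ)
  {a : ℝ} (ha : 0 < a)

/-! ## §1 The source `Q″†(δ_y ⊗ Y)`: block support and size -/

include hι in
omit [Fact (0 < c₀)] in
/-- `‖ι(δ_y ⊗ Y)‖ ≤ √(2c₁)·‖Y‖` (one coarse site; Frobenius `≤ √2·`op on `M₂`). [cite: Balaban1985BackgroundPropagators, (3.16) p.393] -/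
theorem norm_lift_single_le (y : Site (F.P K) (K - n)) (Y : Matrix (Fin 2) (Fin 2) ℂ) :
    ‖ι (Pi.single y Y)‖ ≤ Real.sqrt (2 * c₁) * ‖Y‖ := by
  classical
  have hc₁ : 0 < c₁ := Fact.out
  have hsq : ‖ι (Pi.single y Y)‖ ^ 2 ≤ (Real.sqrt (2 * c₁) * ‖Y‖) ^ 2 := by
    rw [hι, normSq_toL2S_comp_siteShift_eq F h, mul_pow, Real.sq_sqrt (by positivity)]
    have hsum : ∑ Y' : Site (F.P K) (K - n), ∑ j : Fin 2, ∑ k : Fin 2, ‖(Pi.single y Y : Site (F.P K) (K - n) → Matrix (Fin 2) (Fin 2) ℂ) Y' j k‖ ^ 2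
        = ∑ j : Fin 2, ∑ k : Fin 2, ‖Y j k‖ ^ 2 := by
      rw [Finset.sum_eq_single y]
      · rw [Pi.single_eq_same]
      · intro Y' _ hY'; simp [Pi.single_eq_of_ne hY']
      · intro hy; exact absurd (Finset.mem_univ y) hy
    rw [hsum]
    have h2 : ∑ j : Fin 2, ∑ k : Fin 2, ‖Y j k‖ ^ 2 ≤ 2 * ‖Y‖ ^ 2 := by
      have := sum_norm_sq_le_mul_opNorm_sq (N := 2) Y
      simpa using this
    nlinarith [hc₁.le]
  exact (pow_le_pow_iff_left₀ (norm_nonneg _) (by positivity) two_ne_zero).mp hsq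

omit [Fact (0 < c₀)] [Fact (0 < c₁)] in
/-- The block of a coarse site, read on the `TSite` chart, has `(L^d)^{K−n}` points. [cite: Balaban1985BackgroundPropagators, (3.21) p.394] -/
theorem card_blockSites (y : Site (F.P K) (K - n)) :
    ((iterBlock (K - n) y).map (siteEquiv F K).toEmbedding).card = ((F.P K).L ^ (F.P K).d) ^ (K - n) := by
  rw [Finset.card_map]
  exact card_iterBlock (K - n) (by show K - n ≤ F.m + K; have := F.hm; omega) y

include hseq hι hT in
/-- ★ **THE SOURCE `Q″†(δ_y ⊗ Y)` IS SUPPORTED IN THE BLOCK OF `y`** (✓`adjoint_apply_eq_zero_off_block`, read on the `TSite` chart).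
[cite: Balaban1985BackgroundPropagators, (3.21)–(3.25) p.394] -/
theorem equiv_column_source_eq_zero_off_block (y : Site (F.P K) (K - n)) (Y : Matrix (Fin 2) (Fin 2) ℂ)
    (xt : TSite 3 (periodsT3 F K)) (hxt : xt ∉ (iterBlock (K - n) y).map (siteEquiv F K).toEmbedding) :
    WL2.equiv ℂ _ W₂ (T (ι (Pi.single y Y))) xt = 0 := by
  classical
  have hx : iterBlockOf (K - n) ((siteEquiv F K).symm xt) ≠ y := by
    intro hmem
    apply hxt
    rw [Finset.mem_map]
    exact ⟨(siteEquiv F K).symm xt, (mem_iterBlock _ _ _).mpr hmem, by simp⟩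
  have h0 := adjoint_apply_eq_zero_off_block F U₀ Q'' hseq ι (inner_lift_eq_zero_of_disjoint F h ι hι) T hT (Pi.single y Y) y
    (fun y' hy' => Pi.single_eq_of_ne hy' _) ((siteEquiv F K).symm xt) hx
  rw [toL2S_symm_apply, Equiv.apply_symm_apply] at h0
  have : WL2.equiv ℂ _ W₂ (T (ι (Pi.single y Y))) xt = frobEquiv.symm (frobEquiv (WL2.equiv ℂ _ W₂ (T (ι (Pi.single y Y))) xt)) :=
    (LinearEquiv.symm_apply_apply _ _).symm
  rw [this, h0, map_zero]

include hε₀ hε7 hreg hseq hι hT in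
/-- ★ **THE SOURCE IS POINTWISE SMALL**: `‖(Q″†(δ_y ⊗ Y))(x)‖_{W₂} ≤ (5∕4)√(2c₁)∕(c₀ℓ³)·√(2c₁)·‖Y‖` (V2's spike test ✓`norm_equiv_adjoint_apply_le` + `norm_lift_single_le`).
[cite: Balaban1985BackgroundPropagators, (3.16) p.393, (3.24) p.394] -/
theorem norm_equiv_column_source_le (y : Site (F.P K) (K - n)) (Y : Matrix (Fin 2) (Fin 2) ℂ) (xt : TSite 3 (periodsT3 F K)) :
    ‖WL2.equiv ℂ _ W₂ (T (ι (Pi.single y Y))) xt‖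
      ≤ (5 / 4) * Real.sqrt (2 * c₁) * ((((F.P K).L : ℝ) ^ (F.P K).d) ^ (K - n))⁻¹ / c₀ * (Real.sqrt (2 * c₁) * ‖Y‖) := by
  have hc₀ : 0 < c₀ := Fact.out
  have h1 := norm_equiv_adjoint_apply_le F h hε₀ hε7 U₀ hreg Q'' hseq ι hι T hT (ι (Pi.single y Y)) xt
  have h2 := norm_lift_single_le F h ι hι y Y
  have hA0 : 0 ≤ (5 / 4) * Real.sqrt (2 * c₁) * ((((F.P K).L : ℝ) ^ (F.P K).d) ^ (K - n))⁻¹ / c₀ := by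
    have := (F.P K).L_pos; positivity
  exact h1.trans (mul_le_mul_of_nonneg_left h2 hA0)

/-! ## §2 The columns `ψ_y = G_a(Q″†e_y)` are pointwise bounded -/

include hε₀ hε7 hreg hseq hι hT ha in
/-- ★★★ **THE VALUE LETTER OF THE LOD COLUMNS, K-FREE**: for the massive inverse `G` (`hAG`) and every coarse site `y`, fibre value `Y`, at EVERY fine site
`‖(G(Q″†(δ_y ⊗ Y)))(x)‖_{W₂} ≤ B_col·‖Y‖`, `B_col = (2 + (2p₂ + √(3³∕(c₀ℓ³)))·C_P²·√(c₀·(L^d)^{K−n}))·(5∕4)√(2c₁)∕(c₀ℓ³)·√(2c₁)`; at the pin `c₁ = c₀ℓ³`: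
`B_col = (5∕2)·(2 + ((25∕4)a + √27)·max 2 (16∕a))`.  (V2 ✓`norm_equiv_massiveInverse_apply_le` at the block support of §1.)
[cite: Balaban1985BackgroundPropagators, Thm 3.1 (3.42) p.397, (3.21)–(3.25) p.394, (3.49) p.399] -/
theorem norm_equiv_massiveColumn_apply_le
    (G : SiteL2K ℂ 3 (periodsT3 F K) c₀ W₂ →ₗ[ℂ] SiteL2K ℂ 3 (periodsT3 F K) c₀ W₂)
    (hAG : ∀ f, covLapSite F n K c₀ U₀ (G f) + (a : ℂ) • T (ι (Q'' (G f))) = f)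
    (y : Site (F.P K) (K - n)) (Y : Matrix (Fin 2) (Fin 2) ℂ) (xt : TSite 3 (periodsT3 F K)) :
    ‖WL2.equiv ℂ _ W₂ (G (T (ι (Pi.single y Y)))) xt‖
      ≤ (2 + (2 * (a * ((5 / 4) * Real.sqrt (2 * c₁) * ((((F.P K).L : ℝ) ^ (F.P K).d) ^ (K - n))⁻¹ / c₀) *
                  Real.sqrt ((25 / 8) * (c₁ * ((((F.P K).L : ℝ) ^ (F.P K).d) ^ (K - n))⁻¹ / c₀)))
              + Real.sqrt (3 ^ 3 / (c₀ * ((F.L : ℝ) ^ (K - n)) ^ 3)))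
            * max 2 (16 * c₀ * ((F.L : ℝ) ^ (K - n)) ^ 3 / (a * c₁)) * Real.sqrt (c₀ * ((((F.P K).L ^ (F.P K).d) ^ (K - n) : ℕ) : ℝ)))
        * ((5 / 4) * Real.sqrt (2 * c₁) * ((((F.P K).L : ℝ) ^ (F.P K).d) ^ (K - n))⁻¹ / c₀ * (Real.sqrt (2 * c₁) * ‖Y‖)) := by
  classical
  set S : Finset (TSite 3 (periodsT3 F K)) := (iterBlock (K - n) y).map (siteEquiv F K).toEmbedding with hS
  have hcard : (S.card : ℝ) = ((((F.P K).L ^ (F.P K).d) ^ (K - n) : ℕ) : ℝ) := by rw [hS, card_blockSites F y]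
  have h0 := norm_equiv_massiveInverse_apply_le F h hε₀ hε7 U₀ hreg Q'' hseq ι hι T hT ha G hAG (T (ι (Pi.single y Y))) S
    (fun xt' hxt' => equiv_column_source_eq_zero_off_block F h U₀ Q'' hseq ι hι T hT y Y xt' hxt')
    (fun xt' => norm_equiv_column_source_le F h hε₀ hε7 U₀ hreg Q'' hseq ι hι T hT y Y xt') xt
  rw [hcard] at h0
  exact h0

end Summit.QuantumFields.YangMills.Theorems.Prop7MassiveColumnSupBound

end
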